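import Literature.AlgebraicGeometry.Morphisms.CechH1Pullback
import Mathlib.AlgebraicGeometry.Morphisms.Flat
import Mathlib.RingTheory.IsTensorProduct
import HarnessLib

/-!
# Flat base change of sections along `Spec B → Spec A`: `Γ(Z, g⁻¹V) = B ⊗_A Γ(X, V)`

For a cartesian square of schemes over affine bases
```
      Z ──g──▶ X
   f_Z│        │f_X
      ▼        ▼
   Spec B ──▶ Spec A
```
(`IsPullback g f_Z f_X (Spec (A → B))`, `B` an `A`-algebra), an open `V ⊆ X` and an open
`W ⊆ g⁻¹V` of `Z`, this file constructs the **base-change map on sections**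
`B ⊗_A Γ(X, V) → Γ(Z, W)`, `b ⊗ s ↦ f_Z^*(b)|_W · g^*(s)|_W` (`bcSections`), `A`-linearly for the
`A`-structure `Z → Spec B → Spec A` of `Z` (`restrictBase`), and proves it BIJECTIVE for
`W = g⁻¹V`, `V` quasi-compact quasi-separated and `A → B` flat (`bcSections_bijective`: flat base
change of `H⁰`, The Stacks Project, Tag 02KH in degree `0`; EGA III₁ (1.4.15)) — Mathlib's
`isIso_pushoutSection_of_isQuasiSeparated_of_flat_right` (the square `A → Γ(X, V)`, `A → B`,
`Γ(X, V) → Γ(Z, g⁻¹V) ← B` is a pushout of rings), read through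
`CommRingCat.isPushout_iff_isPushout` and `Algebra.IsPushout.equiv`.  The companion `bcPi` does the
same for a finite family of opens at once (`B ⊗_A Π_j Γ(X, O_j) → Π_j Γ(Z, Q_j)`,
`bcPi_bijective`: tensor products commute with finite products) — the form consumed by the Čech
cochains of `Morphisms/CechH1FlatBaseChange`.

Pattern: `Motives/KunnethSections`, `Motives/KunnethCechBaseChange` (the case `A = k` a field,
`B = Γ(U, 𝒪)`), `Morphisms/CechH1Localization` (the case `B = S⁻¹A`).  Everything is proved; no
named facts.  Mathlib searched (pin v4.32):
`isIso_pushoutSection_of_isQuasiSeparated_of_flat_right`, `isIso_pushoutSection_iff`,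
`CommRingCat.isPushout_iff_isPushout`, `Algebra.IsPushout.equiv_tmul`,
`Scheme.ΓSpecIso_naturality`, `Algebra.TensorProduct.productMap` (used); Mathlib has the
pushout statement but not the `B ⊗_A –` form on the tree's `Sections`.

## References

* The Stacks Project, Tag 02KH (Cohomology of Schemes, Lemma 30.5.2: flat base change), degree `0`.
  [StacksProject]
* A. Grothendieck, J. Dieudonné, EGA III₁ (Publ. Math. IHÉS 11, 1961), Prop. (1.4.15). [EGAIII1]
-/

noncomputable section

open CategoryTheory AlgebraicGeometry Limits TopologicalSpace Opposite TensorProduct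

universe u v

namespace Literature.AlgebraicGeometry.Morphisms

variable {A B : Type u} [CommRing A] [CommRing B] [Algebra A B] {X Z : Scheme.{u}}
  (fX : X ⟶ Spec (.of A)) (fZ : Z ⟶ Spec (.of B)) (g : Z ⟶ X)

/-! ## The `A`-structure of a `B`-scheme -/

/-- The `A`-scheme `Z → Spec B → Spec A` underlying a `B`-scheme `f_Z : Z → Spec B`, for an
`A`-algebra `B` (the composite `f_Z ≫ Spec (algebraMap A B)`; an abbreviation). [folklore] -/
abbrev restrictBase (A : Type u) [CommRing A] [Algebra A B] (fZ : Z ⟶ Spec (.of B)) :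
    Z ⟶ Spec (.of A) :=
  fZ ≫ Spec.map (CommRingCat.ofHom (algebraMap A B))

/-- The structure maps are compatible: on `Γ(Z, W)`, `a ↦ (a·1_B)|_W`, i.e.
`algebraMap A Γ(Z, W) = algebraMap B Γ(Z, W) ∘ algebraMap A B` for the `A`-structure through
`Z → Spec B → Spec A` and the `B`-structure through `Z → Spec B` (private plumbing). [folklore] -/
private theorem algebraMap_restrictBase_apply (W : Z.Opens) (a : A) :
    algebraMap A (Sections (restrictBase A fZ) W) a =
      algebraMap B (Sections fZ W) (algebraMap A B a) := by
  change Z.presheaf.map (homOfLE le_top).op (algebraMapΓ (restrictBase A fZ) a) =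
    Z.presheaf.map (homOfLE le_top).op (algebraMapΓ fZ (algebraMap A B a))
  congr 1
  change ((fZ ≫ Spec.map (CommRingCat.ofHom (algebraMap A B))).appTop.hom.comp
      (Scheme.ΓSpecIso (.of A)).inv.hom) a =
    (fZ.appTop.hom.comp (Scheme.ΓSpecIso (.of B)).inv.hom) (algebraMap A B a)
  have hnat := Scheme.ΓSpecIso_inv_naturality (CommRingCat.ofHom (algebraMap A B))
  rw [Scheme.Hom.comp_appTop]
  change (fZ.appTop.hom) (((Scheme.ΓSpecIso (.of A)).inv ≫
      (Spec.map (CommRingCat.ofHom (algebraMap A B))).appTop).hom a) =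
    fZ.appTop.hom ((Scheme.ΓSpecIso (.of B)).inv.hom (algebraMap A B a))
  rw [← hnat]
  rfl

/-- **The structure map `B → Γ(Z, W)`, `b ↦ f_Z^*(b)|_W`, as an `A`-algebra homomorphism** into the
sections of the `A`-scheme `Z → Spec B → Spec A`. [folklore] -/
def toSectionsBase (A : Type u) [CommRing A] [Algebra A B] (fZ : Z ⟶ Spec (.of B)) (W : Z.Opens) :
    B →ₐ[A] Sections (restrictBase A fZ) W :=
  { algebraMap B (Sections fZ W) with
    commutes' := fun a => (algebraMap_restrictBase_apply fZ W a).symm }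

/-- `toSectionsBase` is compatible with restriction (the restriction maps of `𝒪_Z` are `B`-linear;
private plumbing). [folklore] -/
private theorem res_toSectionsBase {W W' : Z.Opens} (h : W' ≤ W) (b : B) :
    Sections.res (restrictBase A fZ) h (toSectionsBase A fZ W b) = toSectionsBase A fZ W' b :=
  (Sections.res fZ h).commutes b

/-! ## The base-change map on sections -/

section One

variable (hg : g ≫ fX = restrictBase A fZ)

/-- **The base-change map on sections** `B ⊗_A Γ(X, V) → Γ(Z, W)` for `W ⊆ g⁻¹V`:
`b ⊗ s ↦ f_Z^*(b)|_W · g^*(s)|_W`, an `A`-algebra homomorphism (the canonical map of the pushout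
square of The Stacks Project, Tag 02KH, degree `0`). [cite: StacksProject, Tag 02KH (degree 0)] -/
def bcSections {V : X.Opens} {W : Z.Opens} (e : W ≤ g ⁻¹ᵁ V) :
    B ⊗[A] Sections fX V →ₐ[A] Sections (restrictBase A fZ) W :=
  Algebra.TensorProduct.productMap (toSectionsBase A fZ W)
    (Sections.comap fX (restrictBase A fZ) g hg e)

/-- `bcSections (b ⊗ s) = f_Z^*(b)|_W · g^*(s)|_W` (unfolding; private). [folklore] -/
@[simp]
private theorem bcSections_tmul {V : X.Opens} {W : Z.Opens} (e : W ≤ g ⁻¹ᵁ V) (b : B)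
    (s : Sections fX V) :
    bcSections fX fZ g hg e (b ⊗ₜ s) =
      toSectionsBase A fZ W b * Sections.comap fX (restrictBase A fZ) g hg e s :=
  Algebra.TensorProduct.productMap_apply_tmul _ _ b s

end One

/-- **Flat base change of `H⁰` on a quasi-compact quasi-separated open**: for the cartesian square
`Z = X ×_{Spec A} Spec B` with `A → B` flat and `V ⊆ X` a quasi-compact quasi-separated open,
`B ⊗_A Γ(X, V) → Γ(Z, g⁻¹V)`, `b ⊗ s ↦ f_Z^*(b) · g^*(s)`, is bijective (Mathlib's
`isIso_pushoutSection_of_isQuasiSeparated_of_flat_right`, transported along `Γ(Spec A) ≅ A`,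
`Γ(Spec B) ≅ B` and compared with `Algebra.IsPushout.equiv` on pure tensors).
[cite: StacksProject, Tag 02KH (Cohomology of Schemes, Lemma 30.5.2), degree 0] -/
theorem bcSections_bijective [Module.Flat A B]
    (H : IsPullback g fZ fX (Spec.map (CommRingCat.ofHom (algebraMap A B)))) {V : X.Opens}
    (hV : IsCompact (V : Set X)) (hV' : IsQuasiSeparated (V : Set X)) :
    Function.Bijective (bcSections fX fZ g H.w (le_refl (g ⁻¹ᵁ V))) := by
  -- `Γ(Z, g⁻¹V)` (with its `A`-structure) as a `B`-algebra, compatibly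
  letI : Algebra B (Sections (restrictBase A fZ) (g ⁻¹ᵁ V)) :=
    inferInstanceAs (Algebra B (Sections fZ (g ⁻¹ᵁ V)))
  haveI : IsScalarTower A B (Sections (restrictBase A fZ) (g ⁻¹ᵁ V)) :=
    IsScalarTower.of_algebraMap_eq fun a => algebraMap_restrictBase_apply fZ (g ⁻¹ᵁ V) a
  -- ... and as a `Γ(X, V)`-algebra through `g^*`, compatibly with the `A`-structures
  letI : Algebra (Sections fX V) (Sections (restrictBase A fZ) (g ⁻¹ᵁ V)) :=
    (Sections.comap fX (restrictBase A fZ) g H.w (le_refl (g ⁻¹ᵁ V))).toRingHom.toAlgebra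
  haveI : IsScalarTower A (Sections fX V) (Sections (restrictBase A fZ) (g ⁻¹ᵁ V)) :=
    IsScalarTower.of_algebraMap_eq fun a =>
      ((Sections.comap fX (restrictBase A fZ) g H.w (le_refl (g ⁻¹ᵁ V))).commutes a).symm
  -- flatness of `Spec B → Spec A`
  haveI : Flat (Spec.map (CommRingCat.ofHom (algebraMap A B))) := by
    rw [HasRingHomProperty.Spec_iff (P := @Flat)]
    exact RingHom.flat_algebraMap_iff.mpr inferInstance
  -- Mathlib's cartesian-square statement, with `U_S = ⊤`, `U_T = ⊤`, `U_X = V`, `U_Y = g⁻¹V`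
  have hsq := (isIso_pushoutSection_iff H (US := ⊤) (UT := ⊤) (UX := V) le_top le_top
      (UY := g ⁻¹ᵁ V) (by simp)).mp
    (isIso_pushoutSection_of_isQuasiSeparated_of_flat_right H le_top le_top (by simp)
      (isAffineOpen_top _) (isAffineOpen_top _) hV hV')
  -- replace the corners `Γ(Spec A, ⊤)`, `Γ(Spec B, ⊤)` by `A`, `B`
  have hsq' : IsPushout (CommRingCat.ofHom (algebraMap A (Sections fX V)))
      (CommRingCat.ofHom (algebraMap A B))
      (CommRingCat.ofHom (algebraMap (Sections fX V) (Sections (restrictBase A fZ) (g ⁻¹ᵁ V))))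
      (CommRingCat.ofHom (algebraMap B (Sections (restrictBase A fZ) (g ⁻¹ᵁ V)))) := by
    refine hsq.of_iso (Scheme.ΓSpecIso (.of A)) (Iso.refl _) (Scheme.ΓSpecIso (.of B))
      (Iso.refl _) ?_ ?_ ?_ ?_
    · -- `A → Γ(X, V)`
      simp only [Iso.refl_hom]
      rw [← Iso.inv_comp_eq]
      rfl
    · -- `A → B`
      have happ : (Spec.map (CommRingCat.ofHom (algebraMap A B))).appLE ⊤ ⊤ le_top =
          (Spec.map (CommRingCat.ofHom (algebraMap A B))).appTop := rfl
      rw [happ]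
      exact Scheme.ΓSpecIso_naturality _
    · -- `Γ(X, V) → Γ(Z, g⁻¹V)`
      simp only [Iso.refl_hom]
      rfl
    · -- `B → Γ(Z, g⁻¹V)`
      simp only [Iso.refl_hom]
      rw [← Iso.inv_comp_eq]
      rfl
  haveI hP : Algebra.IsPushout A B (Sections fX V) (Sections (restrictBase A fZ) (g ⁻¹ᵁ V)) :=
    CommRingCat.isPushout_iff_isPushout.mp hsq'.flip
  let e := Algebra.IsPushout.equiv A B (Sections fX V) (Sections (restrictBase A fZ) (g ⁻¹ᵁ V))
  have he : ∀ t, e t = bcSections fX fZ g H.w (le_refl (g ⁻¹ᵁ V)) t := by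
    intro t
    induction t using TensorProduct.induction_on with
    | zero => rw [map_zero, map_zero]
    | tmul b s => rw [Algebra.IsPushout.equiv_tmul, bcSections_tmul]; rfl
    | add x y hx hy => rw [map_add, map_add, hx, hy]
  have : (bcSections fX fZ g H.w (le_refl (g ⁻¹ᵁ V)) : _ → _) = e := funext fun t => (he t).symm
  rw [this]
  exact e.bijective

/-! ## A finite family of opens at once: `B ⊗_A Π_j Γ(X, O_j) → Π_j Γ(Z, Q_j)` -/

section Pi

variable (hg : g ≫ fX = restrictBase A fZ) {J : Type v} (O : J → X.Opens) (Q : J → Z.Opens)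
  (hQ : ∀ j, Q j ≤ g ⁻¹ᵁ (O j))

/-- **The base-change map into a product of section rings**: for opens `Q_j ⊆ g⁻¹O_j` of `Z`,
`B ⊗_A Π_j Γ(X, O_j) → Π_j Γ(Z, Q_j)`, `b ⊗ (s_j)_j ↦ (f_Z^*(b) · g^*(s_j))_j`.
[cite: StacksProject, Tag 02KH (degree 0)] -/
def bcPi : B ⊗[A] (∀ j, Sections fX (O j)) →ₗ[A] ∀ j, Sections (restrictBase A fZ) (Q j) :=
  TensorProduct.lift
    (LinearMap.mk₂ A
      (fun b s j =>
        toSectionsBase A fZ (Q j) b * Sections.comap fX (restrictBase A fZ) g hg (hQ j) (s j))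
      (fun b b' s => by funext j; simp only [map_add, add_mul, Pi.add_apply])
      (fun c b s => by funext j; simp only [map_smul, smul_mul_assoc, Pi.smul_apply])
      (fun b s s' => by funext j; simp only [Pi.add_apply, map_add, mul_add])
      (fun c b s => by funext j; simp only [Pi.smul_apply, map_smul, mul_smul_comm]))

/-- `bcPi (b ⊗ s) = (f_Z^*(b) · g^*(s_j))_j` (unfolding; private). [folklore] -/
@[simp]
private theorem bcPi_tmul (b : B) (s : ∀ j, Sections fX (O j)) (j : J) :
    bcPi fX fZ g hg O Q hQ (b ⊗ₜ s) j =
      toSectionsBase A fZ (Q j) b * Sections.comap fX (restrictBase A fZ) g hg (hQ j) (s j) :=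
  rfl

/-- Each component of `bcPi` is `bcSections` for `O_j`, `g⁻¹O_j` followed by the restriction
`Γ(Z, g⁻¹O_j) → Γ(Z, Q_j)`, applied to the `j`-th component (private). [folklore] -/
private theorem bcPi_apply_eq (T : B ⊗[A] (∀ j, Sections fX (O j))) (j : J) :
    bcPi fX fZ g hg O Q hQ T j =
      Sections.res (restrictBase A fZ) (hQ j)
        (bcSections fX fZ g hg (le_refl (g ⁻¹ᵁ (O j)))
          (LinearMap.lTensor B (LinearMap.proj j) T)) := by
  induction T using TensorProduct.induction_on with
  | zero => simp only [map_zero, Pi.zero_apply]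
  | tmul b s =>
      rw [bcPi_tmul, LinearMap.lTensor_tmul, LinearMap.proj_apply, bcSections_tmul, map_mul,
        res_toSectionsBase, Sections.res_comap]
  | add x y hx hy => simp only [map_add, Pi.add_apply, hx, hy]

/-- Reassembling a tensor from its components: `T = Σ_j (id ⊗ ι_j)((id ⊗ pr_j) T)` for a finite
index type (private linear algebra). [folklore] -/
private theorem sum_lTensor_single_lTensor_proj [Fintype J] [DecidableEq J]
    (T : B ⊗[A] (∀ j, Sections fX (O j))) :
    ∑ j, LinearMap.lTensor B (LinearMap.single A (fun j => Sections fX (O j)) j)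
      (LinearMap.lTensor B (LinearMap.proj j) T) = T := by
  induction T using TensorProduct.induction_on with
  | zero => simp only [map_zero, Finset.sum_const_zero]
  | tmul b s =>
      simp only [LinearMap.lTensor_tmul, LinearMap.proj_apply, LinearMap.coe_single]
      rw [← tmul_sum, Finset.univ_sum_single]
  | add x y hx hy => simp only [map_add, Finset.sum_add_distrib, hx, hy]

/-- Components of a reassembled tensor (private linear algebra). [folklore] -/
private theorem lTensor_proj_lTensor_single [DecidableEq J] {j j' : J}
    (t : B ⊗[A] Sections fX (O j)) :
    LinearMap.lTensor B (LinearMap.proj j')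
      (LinearMap.lTensor B (LinearMap.single A (fun j => Sections fX (O j)) j) t) =
        if h : j = j' then h ▸ t else 0 := by
  rw [← LinearMap.comp_apply, ← LinearMap.lTensor_comp]
  split_ifs with h
  · subst h
    rw [LinearMap.proj_comp_single_same, LinearMap.lTensor_id, LinearMap.id_apply]
  · rw [LinearMap.proj_comp_single_ne A _ j' j (Ne.symm h), LinearMap.lTensor_zero,
      LinearMap.zero_apply]

/-- **`B ⊗_A Π_j Γ(X, O_j) → Π_j Γ(Z, g⁻¹O_j)` is bijective** for `J` finite, `A → B` flat, the
`O_j` quasi-compact quasi-separated and `Q_j = g⁻¹O_j` (flat base change of `H⁰`,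
`bcSections_bijective`, in each component; tensor products commute with finite products).
[cite: StacksProject, Tag 02KH (degree 0)] -/
theorem bcPi_bijective [Finite J] [Module.Flat A B]
    (H : IsPullback g fZ fX (Spec.map (CommRingCat.ofHom (algebraMap A B))))
    (hO : ∀ j, IsCompact (O j : Set X)) (hO' : ∀ j, IsQuasiSeparated (O j : Set X))
    (hQ' : ∀ j, g ⁻¹ᵁ (O j) ≤ Q j) :
    Function.Bijective (bcPi fX fZ g H.w O Q hQ) := by
  classical
  cases nonempty_fintype J
  have hθ : ∀ j, Function.Bijective (bcSections fX fZ g H.w (le_refl (g ⁻¹ᵁ (O j)))) :=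
    fun j => bcSections_bijective fX fZ g H (hO j) (hO' j)
  -- the restrictions along `Q_j = g⁻¹O_j` are bijective
  have hρ : ∀ j, Function.Bijective
      (Sections.res (restrictBase A fZ) (V := g ⁻¹ᵁ (O j)) (W := Q j) (hQ j)) := by
    intro j
    refine Function.bijective_iff_has_inverse.mpr
      ⟨Sections.res (restrictBase A fZ) (V := Q j) (W := g ⁻¹ᵁ (O j)) (hQ' j), ?_, ?_⟩
    · intro s; rw [Sections.res_res, Sections.res_self]
    · intro s; rw [Sections.res_res, Sections.res_self]
  constructor
  · intro T T' hTT'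
    rw [← sub_eq_zero] at hTT' ⊢
    rw [← map_sub] at hTT'
    set D := T - T'
    have hD : ∀ j, LinearMap.lTensor B (LinearMap.proj j) D = 0 := by
      intro j
      have h := congrFun hTT' j
      rw [bcPi_apply_eq, Pi.zero_apply] at h
      have h' : bcSections fX fZ g H.w (le_refl (g ⁻¹ᵁ (O j)))
          (LinearMap.lTensor B (LinearMap.proj j) D) = 0 :=
        (hρ j).1 (h.trans (map_zero _).symm)
      exact (hθ j).1 (h'.trans (map_zero _).symm)
    rw [← sum_lTensor_single_lTensor_proj fX O D]
    simp only [hD, map_zero, Finset.sum_const_zero]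
  · intro F
    choose t ht using fun j => ((hρ j).comp (hθ j)).2 (F j)
    refine ⟨∑ j, LinearMap.lTensor B (LinearMap.single A (fun j => Sections fX (O j)) j) (t j),
      ?_⟩
    funext j'
    rw [bcPi_apply_eq, map_sum]
    simp only [lTensor_proj_lTensor_single, Finset.sum_dite_eq', Finset.mem_univ, if_true]
    exact ht j'

end Pi

end Literature.AlgebraicGeometry.Morphisms

end
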